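import Literature.Computability.Cryptography.GGMHybridRuns
import Literature.Computability.Cryptography.GGM
import HarnessLib

/-!
# The GGM hybrid argument, II: the level hybrids, the simulator's pools and the telescoping sum

Topic `Literature/Computability/Cryptography`; second companion file of `GGM.lean` towards the
discharge of `Literature.Computability.Cryptography.GGM1986_thm3`, continuing `GGMHybridRuns.lean`
(runs under answer rules, the round-indexed lazy rule `lazyRule`, the eager oracle `eagerOracle`,
and the lazy/eager sampling principle `uProb_lazy_eq_eager`). Here the abstract keys and values are
specialised to the GGM tree (GGM 1986, pp. 800–802; Goldreich 2001, proof of Thm. 3.6.6):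

* `GGMHyb.keyAt n i u` — the level-`i` vertex on the path of a query `u ∈ {0,1}ⁿ` (its `i`-bit
  prefix; invalid queries have no key); `GGMHyb.hybOracle G n i T` — the **level-`i` hybrid**
  `H_n^i = f_{U⁽¹⁾,…,U⁽²ⁱ⁾}` of Goldreich (p. 187) / GGM's `A_i` as an eager oracle: the label of the
  level-`i` vertex is read off the table `T : {0,1}ⁱ → {0,1}ⁿ` and the walk continues with `G`
  (`postSeed`); its extremes are the real oracle `f_k` (`hybOracle_zero`) and the uniformly random
  function (`hybOracle_self`);
* the **simulator's pools** (Goldreich's algorithm `D` with checkpoint `i`, p. 188; GGM's `A_T`):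
  a fresh level-`i` vertex met at round `m` receives the `2n`-bit string `V_j(m)` whose halves
  label its two children (`postPair`), where — for the slot `j` of the challenge sample and blocks
  `blk m ∈ {0,1}²ⁿ` of the simulator's coins — `V_j(m) = blk m` for `m < j`, the sample for
  `m = j`, and `G` of the first half of `blk m` for `m > j`; `poolU` is the pool with a uniform
  sample `u`, `poolG` the pool with a pseudorandom sample `G σ`;
* PROVED, for every transcript algorithm `M`, input `x` (carrying the adversary's coins), round
  budget `t` and output event `S`:
  `uProb_poolG_succ` (the coordinate permutation `swapEquiv`: slot `j + 1` with a `G`-sample is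
  slot `j` with a uniform sample), `uProb_poolG_zero` (slot `0` with a `G`-sample is the level-`i`
  hybrid — lazy/eager principle with seed values), `uProb_poolU_last` (slot `t - 1` with a uniform
  sample is the level-`(i+1)` hybrid — lazy/eager principle with pair values, then the table
  bijection `pairTableEquiv : ({0,1}ⁱ → {0,1}²ⁿ) ≃ ({0,1}ⁱ⁺¹ → {0,1}ⁿ)`), and the **telescoping
  identity** `sum_sum_uProb_poolG_sub_poolU` :
  `Σ_{i<n} Σ_{j<t} (Pr[pool G, (i,j)] − Pr[pool U, (i,j)]) = Pr[M^{f_{U_n}}] − Pr[M^{H_n}]`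
  (GGM 1986, p. 802: "these probabilities differ by at least `(1/k)·|p_k^0 − p_k^k|`";
  Goldreich 2001, p. 192, the display before §3.6.3).

All statements are exact counting identities (`uProb`, `FiniteHybrids.lean`); the coins of the
adversary are part of the fixed input `x`, and the averaging over them, the index bits and the
`PMF` games is done in `GGMProofs.lean`.

## References

* O. Goldreich, S. Goldwasser, S. Micali, *How to construct random functions*, J. ACM 33 (1986),
  §3.3, proof of Thm. 3 (pp. 800–802).
* O. Goldreich, *Foundations of Cryptography I*, CUP 2001, proof of Thm. 3.6.6 (pp. 187–192).
-/

namespace Literature.Computability.Cryptography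

open _root_.Computability Complexity Complexity.OracleAlg Finset

namespace GGMHyb

variable {β : Type}

/-! ### Bit vectors: halves and appends -/

section Vec

variable {n : ℕ}

/-- The first half of a `2n`-bit vector. [folklore] -/
def fstHalf (v : List.Vector Bool (2 * n)) : List.Vector Bool n :=
  ⟨v.toList.take n, by rw [List.length_take, v.toList_length]; omega⟩

/-- The second half of a `2n`-bit vector. [folklore] -/
def sndHalf (v : List.Vector Bool (2 * n)) : List.Vector Bool n :=
  ⟨v.toList.drop n, by rw [List.length_drop, v.toList_length]; omega⟩

/-- Concatenation of two `n`-bit vectors. [folklore] -/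
def vappend (a b : List.Vector Bool n) : List.Vector Bool (2 * n) :=
  ⟨a.toList ++ b.toList, by rw [List.length_append, a.toList_length, b.toList_length]; omega⟩

/-- The string of the first half. [folklore] -/
@[simp] theorem toList_fstHalf (v : List.Vector Bool (2 * n)) : (fstHalf v).toList = v.toList.take n := rfl

/-- The string of the second half. [folklore] -/
@[simp] theorem toList_sndHalf (v : List.Vector Bool (2 * n)) : (sndHalf v).toList = v.toList.drop n := rfl

/-- The string of a concatenation. [folklore] -/
@[simp] theorem toList_vappend (a b : List.Vector Bool n) : (vappend a b).toList = a.toList ++ b.toList := rfl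

/-- First half of a concatenation. [folklore] -/
@[simp] theorem fstHalf_vappend (a b : List.Vector Bool n) : fstHalf (vappend a b) = a :=
  List.Vector.eq _ _ (by simp [List.take_left' a.toList_length])

/-- Second half of a concatenation. [folklore] -/
@[simp] theorem sndHalf_vappend (a b : List.Vector Bool n) : sndHalf (vappend a b) = b :=
  List.Vector.eq _ _ (by simp [List.drop_left' a.toList_length])

/-- A vector is the concatenation of its halves. [folklore] -/
@[simp] theorem vappend_fstHalf_sndHalf (v : List.Vector Bool (2 * n)) : vappend (fstHalf v) (sndHalf v) = v :=
  List.Vector.eq _ _ (by simp)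

/-- The half selected by a bit (`0`: first, `1`: second) — the child of a vertex whose two children
are labelled by the halves of a `2n`-bit string. [Goldreich 2001, p. 188 (`P_σ(α)`)] [folklore] -/
def half (b : Bool) (v : List.Vector Bool (2 * n)) : List.Vector Bool n := if b then sndHalf v else fstHalf v

/-- The first `i` bits of an `(i+1)`-bit vector. [folklore] -/
def vinit {i : ℕ} (κ : List.Vector Bool (i + 1)) : List.Vector Bool i :=
  ⟨κ.toList.take i, by rw [List.length_take, κ.toList_length]; omega⟩

/-- Appending one bit. [folklore] -/
def vsnoc {i : ℕ} (κ : List.Vector Bool i) (b : Bool) : List.Vector Bool (i + 1) :=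
  ⟨κ.toList ++ [b], by rw [List.length_append, κ.toList_length]; rfl⟩

/-- The last bit of an `(i+1)`-bit vector. [folklore] -/
def lastBit {i : ℕ} (κ : List.Vector Bool (i + 1)) : Bool := κ.toList.getD i false

/-- `vinit (vsnoc κ b) = κ`. [folklore] -/
@[simp] theorem vinit_vsnoc {i : ℕ} (κ : List.Vector Bool i) (b : Bool) : vinit (vsnoc κ b) = κ :=
  List.Vector.eq _ _ (by simp [vinit, vsnoc, List.take_left' κ.toList_length])

/-- `lastBit (vsnoc κ b) = b`. [folklore] -/
@[simp] theorem lastBit_vsnoc {i : ℕ} (κ : List.Vector Bool i) (b : Bool) : lastBit (vsnoc κ b) = b := by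
  simp [lastBit, vsnoc, List.getD_eq_getElem?_getD, κ.toList_length]

/-- An `(i+1)`-bit vector is its first `i` bits followed by its last bit. [folklore] -/
@[simp] theorem vsnoc_vinit_lastBit {i : ℕ} (κ : List.Vector Bool (i + 1)) : vsnoc (vinit κ) (lastBit κ) = κ := by
  apply List.Vector.eq
  simp only [vsnoc, vinit, lastBit, List.Vector.toList_mk, List.getD_eq_getElem?_getD]
  have h : i < κ.toList.length := by rw [κ.toList_length]; exact Nat.lt_succ_self i
  rw [List.getElem?_eq_getElem h, Option.getD_some]
  conv_rhs => rw [← List.take_append_drop i κ.toList, List.drop_eq_getElem_cons h]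
  congr 1
  have : List.drop (i + 1) κ.toList = [] := List.drop_eq_nil_of_le (by rw [κ.toList_length])
  rw [this]

end Vec

/-! ### Keys, labels and the level hybrids -/

section Hybrids

variable (G : List Bool → List Bool) (n : ℕ)

/-- The key of a query at level `i`: its `i`-bit prefix when the query is a valid `n`-bit string
(`none` otherwise; junk `none` when `i > n`, a case never used). [Goldreich 2001, p. 188 ("checking
to see if its `k`-bit-long prefix equals the `k`-bit-long prefix of a previous query")] [folklore] -/
def keyAt (i : ℕ) (u : List Bool) : Option (List.Vector Bool i) :=
  if h : u.length = n ∧ i ≤ n then some ⟨u.take i, by rw [List.length_take, h.1, min_eq_left h.2]⟩ else none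

/-- A query has a level-`i` key iff it is a valid `n`-bit string (for `i ≤ n`). [folklore] -/
theorem keyAt_eq_some_iff {i : ℕ} (hi : i ≤ n) (u : List Bool) :
    (∃ κ, keyAt n i u = some κ) ↔ u.length = n := by
  unfold keyAt
  constructor
  · rintro ⟨κ, h⟩
    by_cases hu : u.length = n ∧ i ≤ n
    · exact hu.1
    · rw [dif_neg hu] at h; exact absurd h (by simp)
  · intro h
    exact ⟨_, dif_pos ⟨h, hi⟩⟩

/-- The length of a keyed query. [folklore] -/
theorem length_eq_of_keyAt_eq_some {i : ℕ} {u : List Bool} {κ : List.Vector Bool i}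
    (h : keyAt n i u = some κ) : u.length = n ∧ i ≤ n := by
  unfold keyAt at h
  by_cases hu : u.length = n ∧ i ≤ n
  · exact hu
  · rw [dif_neg hu] at h; exact absurd h (by simp)

/-- The value of the key. [folklore] -/
theorem keyAt_of_length_eq {i : ℕ} (hi : i ≤ n) {u : List Bool} (h : u.length = n) :
    keyAt n i u = some ⟨u.take i, by rw [List.length_take, h, min_eq_left hi]⟩ := by
  unfold keyAt
  rw [dif_pos ⟨h, hi⟩]

/-- Continuing the walk from a level-`i` label: `post (s) (u) = G_{uₙ}(⋯G_{u_{i+1}}(s)⋯)`.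
[Goldreich 2001, p. 187 (`f_{s₁,…,s_{2^k}}`)] [folklore] -/
def postSeed (i : ℕ) (s : List.Vector Bool n) (u : List Bool) : List Bool :=
  ggmEval G s.toList (u.drop i)

/-- Continuing the walk from the labels of the two children of a level-`i` vertex, stored as the
halves of a `2n`-bit string: `G_{uₙ}(⋯G_{u_{i+2}}(P_{u_{i+1}}(v))⋯)`. [Goldreich 2001, p. 188] [folklore] -/
def postPair (i : ℕ) (v : List.Vector Bool (2 * n)) (u : List Bool) : List Bool :=
  ggmEval G (half (u.getD i false) v).toList (u.drop (i + 1))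

/-- **The level-`i` hybrid** as an eager oracle: a valid query `u` is answered by walking from the
label `T (u ↾ i)` of its level-`i` vertex. [Goldreich 2001, proof of Thm. 3.6.6 (`H_n^k`, p. 187);
GGM 1986, p. 800 (algorithm `A_i`)] [folklore] -/
def hybOracle (i : ℕ) (T : List.Vector Bool i → List.Vector Bool n) : Oracle :=
  eagerOracle (keyAt n i) (postSeed G n i) T

/-- The hybrid oracle on a valid query. [folklore] -/
theorem hybOracle_of_length_eq {i : ℕ} (hi : i ≤ n) (T : List.Vector Bool i → List.Vector Bool n)
    {u : List Bool} (h : u.length = n) :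
    hybOracle G n i T u = ggmEval G (T ⟨u.take i, by rw [List.length_take, h, min_eq_left hi]⟩).toList (u.drop i) := by
  unfold hybOracle
  rw [eagerOracle_apply, keyAt_of_length_eq n hi h]
  rfl

/-- The hybrid oracle on an invalid query. [folklore] -/
theorem hybOracle_of_length_ne {i : ℕ} (T : List.Vector Bool i → List.Vector Bool n)
    {u : List Bool} (h : u.length ≠ n) : hybOracle G n i T u = [] := by
  unfold hybOracle
  rw [eagerOracle_apply]
  unfold keyAt
  rw [dif_neg (fun h' => h h'.1)]

/-- **The extreme hybrid `H_n^0` is the real oracle** `f_k` of the GGM ensemble with key the root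
label. [Goldreich 2001, p. 187 ("`H_n^0` is identical with `F_n`")] [folklore] -/
theorem hybOracle_zero (T : List.Vector Bool 0 → List.Vector Bool n) :
    hybOracle G n 0 T = oracleOfFnAt n (ggmEnsemble G n (T ⟨[], rfl⟩).toList) := by
  funext u
  by_cases h : u.length = n
  · rw [hybOracle_of_length_eq G n (Nat.zero_le n) T h, oracleOfFnAt_apply_of_length_eq _ h,
      ggmEnsemble_apply, List.drop_zero]
    rfl
  · rw [hybOracle_of_length_ne G n T h, oracleOfFnAt_apply_of_length_ne _ h]

/-- **The extreme hybrid `H_n^n` is the uniformly random function** given by its table.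
[Goldreich 2001, p. 187 ("`H_n^n` is identical to `H_n`")] [folklore] -/
theorem hybOracle_self (T : List.Vector Bool n → List.Vector Bool n) :
    hybOracle G n n T = oracleOfTable T := by
  funext u
  by_cases h : u.length = n
  · rw [hybOracle_of_length_eq G n le_rfl T h, oracleOfTable_apply_of_length_eq T h,
      List.drop_eq_nil_of_le h.le, ggmEval_nil]
    congr 2
    exact List.Vector.eq _ _ (by simp [List.take_of_length_le h.le])
  · rw [hybOracle_of_length_ne G n T h, oracleOfTable_apply_of_length_ne T h]

variable (hG : ∀ s, (G s).length = 2 * s.length)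

/-- `G` on `n`-bit vectors, as a `2n`-bit vector. [Goldreich 2001, Construction 3.6.5] [folklore] -/
def Gvec (v : List.Vector Bool n) : List.Vector Bool (2 * n) := ⟨G v.toList, by rw [hG, v.toList_length]⟩

/-- The string of `Gvec`. [folklore] -/
@[simp] theorem toList_Gvec (v : List.Vector Bool n) : (Gvec G n hG v).toList = G v.toList := rfl

/-- **Placing the halves of `G σ` at the two children has the same effect as placing `σ` at the
parent**: `postPair (G σ) u = postSeed σ u` on valid queries. [Goldreich 2001, p. 189 ("putting the
two halves of the pseudorandom strings at level `k+1` has exactly the same effect")] [folklore] -/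
theorem postPair_Gvec {i : ℕ} (σ : List.Vector Bool n) {u : List Bool} (hu : u.length = n) (hi : i < n) :
    postPair G n i (Gvec G n hG σ) u = postSeed G n i σ u := by
  unfold postPair postSeed
  have hi' : i < u.length := by rw [hu]; exact hi
  conv_rhs => rw [List.drop_eq_getElem_cons hi', ggmEval_cons]
  congr 1
  rw [List.getD_eq_getElem?_getD, List.getElem?_eq_getElem hi', Option.getD_some]
  unfold half
  cases u[i]
  · simp [ggmStep, σ.toList_length]
  · simp [ggmStep, σ.toList_length]

/-- The lazy rules with pair values `G σ` and with seed values `σ` coincide. [folklore] -/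
theorem lazyRule_postPair_Gvec {M : OracleAlg β} {x : List Bool} {i : ℕ} (hi : i < n)
    (pool : ℕ → List.Vector Bool n) :
    lazyRule M x (keyAt n i) (postPair G n i) (fun m => Gvec G n hG (pool m)) =
      lazyRule M x (keyAt n i) (postSeed G n i) pool := by
  funext E u
  unfold lazyRule
  cases hκ : keyAt n i u with
  | none => rfl
  | some κ =>
    simp only
    exact postPair_Gvec G n hG _ (length_eq_of_keyAt_eq_some n hκ).1 hi

end Hybrids

/-! ### Runs under the lazy rule only read the pool below the round budget -/

section PoolCongr

variable (M : OracleAlg β) (x : List Bool) {K V : Type} [DecidableEq K] (key : List Bool → Option K)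
  (post : V → List Bool → List Bool) (t : ℕ)

/-- Two pools agreeing below the round budget give the same lazy run. [folklore] -/
theorem runRule_lazyRule_congr {pool₁ pool₂ : ℕ → V} (h : ∀ m < t, pool₁ m = pool₂ m) :
    runRule M x (lazyRule M x key post pool₁) t [] = runRule M x (lazyRule M x key post pool₂) t [] := by
  refine runRule_congr M x t fun j hj u _ => ?_
  set E := traceR M x (lazyRule M x key post pool₁) j with hE
  have hlen : E.length ≤ j := length_traceR_le M x (lazyRule M x key post pool₁) j
  show lazyRule M x key post pool₁ E u = lazyRule M x key post pool₂ E u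
  unfold lazyRule
  cases key u with
  | none => rfl
  | some κ =>
    simp only
    have hidx : (firstIdx M x key E κ).getD E.length < t := by
      cases hf : firstIdx M x key E κ with
      | none => simp only [Option.getD_none]; omega
      | some k =>
        simp only [Option.getD_some]
        have := lt_length_of_firstIdx_eq_some M x key hf
        omega
    rw [h _ hidx]

end PoolCongr

/-! ### The simulator's pools -/

section Pools

variable (G : List Bool → List Bool) (n : ℕ) (hG : ∀ s, (G s).length = 2 * s.length) (t : ℕ)

/-- The sample space of the simulator at security parameter `n` with round budget `t` (besides the
adversary's own coins): `t` blocks of `2n` coins, a seed `σ ∈ {0,1}ⁿ` (of a pseudorandom sample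
`G σ`), a uniform sample `u ∈ {0,1}²ⁿ`. [Goldreich 2001, proof of Thm. 3.6.6] [folklore] -/
abbrev Ω (t n : ℕ) : Type :=
  (Fin t → List.Vector Bool (2 * n)) × List.Vector Bool n × List.Vector Bool (2 * n)

/-- **The pool with a uniform sample in slot `j`**: `V_j(m) = blk m` (`m < j`), `u` (`m = j`),
`G(blk m ↾ n)` (`m > j`). [Goldreich 2001, p. 188 (algorithm `D`); GGM 1986, p. 801 (`A_T`)] [folklore] -/
def poolU (j : ℕ) (ω : Ω t n) (m : ℕ) : List.Vector Bool (2 * n) :=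
  if m < j then ext t ω.1 m else if m = j then ω.2.2 else Gvec G n hG (fstHalf (ext t ω.1 m))

/-- **The pool with a pseudorandom sample `G σ` in slot `j`.** [Goldreich 2001, p. 188] [folklore] -/
def poolG (j : ℕ) (ω : Ω t n) (m : ℕ) : List.Vector Bool (2 * n) :=
  if m < j then ext t ω.1 m else if m = j then Gvec G n hG ω.2.1 else Gvec G n hG (fstHalf (ext t ω.1 m))

variable {t}

/-- **Shifting the sample slot** — the coordinate permutation under which the pool with a
`G`-sample in slot `j + 1` becomes the pool with a uniform sample in slot `j`: swap `blk j ↔ u` and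
`blk (j+1) ↾ n ↔ σ`. It is an involution. [Goldreich 2001, §3.2.3 (hybrid technique: neighbouring
hybrids)] [folklore] -/
def swapFun (j : ℕ) (hj : j + 1 < t) (ω : Ω t n) : Ω t n :=
  (fun m => if m.1 = j then ω.2.2 else if m.1 = j + 1 then vappend ω.2.1 (sndHalf (ω.1 m)) else ω.1 m,
   fstHalf (ω.1 ⟨j + 1, hj⟩), ω.1 ⟨j, Nat.lt_of_succ_lt hj⟩)

/-- The blocks after the swap. [folklore] -/
theorem swapFun_fst_apply (j : ℕ) (hj : j + 1 < t) (ω : Ω t n) (m : Fin t) :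
    (swapFun n j hj ω).1 m =
      if m.1 = j then ω.2.2 else if m.1 = j + 1 then vappend ω.2.1 (sndHalf (ω.1 m)) else ω.1 m :=
  rfl

/-- The seed after the swap. [folklore] -/
theorem swapFun_snd_fst (j : ℕ) (hj : j + 1 < t) (ω : Ω t n) :
    (swapFun n j hj ω).2.1 = fstHalf (ω.1 ⟨j + 1, hj⟩) :=
  rfl

/-- The sample after the swap. [folklore] -/
theorem swapFun_snd_snd (j : ℕ) (hj : j + 1 < t) (ω : Ω t n) :
    (swapFun n j hj ω).2.2 = ω.1 ⟨j, Nat.lt_of_succ_lt hj⟩ :=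
  rfl

/-- The blocks after the swap, at a numeric index. [folklore] -/
theorem swapFun_fst_mk (j : ℕ) (hj : j + 1 < t) (ω : Ω t n) (m : ℕ) (hm : m < t) :
    (swapFun n j hj ω).1 ⟨m, hm⟩ =
      if m = j then ω.2.2 else if m = j + 1 then vappend ω.2.1 (sndHalf (ω.1 ⟨m, hm⟩)) else ω.1 ⟨m, hm⟩ :=
  rfl

/-- The swap is an involution. [folklore] -/
theorem swapFun_involutive (j : ℕ) (hj : j + 1 < t) : Function.Involutive (swapFun n j hj) := by
  intro ω
  refine Prod.ext ?_ (Prod.ext ?_ ?_)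
  · funext m
    rw [swapFun_fst_apply]
    by_cases h1 : m.1 = j
    · rw [if_pos h1, swapFun_snd_snd]
      exact congrArg ω.1 (Fin.ext h1.symm : (⟨j, Nat.lt_of_succ_lt hj⟩ : Fin t) = m)
    · rw [if_neg h1]
      by_cases h2 : m.1 = j + 1
      · rw [if_pos h2, swapFun_snd_fst, swapFun_fst_apply, if_neg h1, if_pos h2, sndHalf_vappend]
        have hm : (⟨j + 1, hj⟩ : Fin t) = m := Fin.ext h2.symm
        rw [hm, vappend_fstHalf_sndHalf]
      · rw [if_neg h2, swapFun_fst_apply, if_neg h1, if_neg h2]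
  · rw [swapFun_snd_fst, swapFun_fst_apply]
    have h1 : ¬ ((⟨j + 1, hj⟩ : Fin t).1 = j) := Nat.succ_ne_self j
    have h2 : (⟨j + 1, hj⟩ : Fin t).1 = j + 1 := rfl
    rw [if_neg h1, if_pos h2, fstHalf_vappend]
  · rw [swapFun_snd_snd, swapFun_fst_apply]
    have h1 : (⟨j, Nat.lt_of_succ_lt hj⟩ : Fin t).1 = j := rfl
    rw [if_pos h1]

/-- The swap as a permutation of the sample space. [folklore] -/
def swapEquiv (j : ℕ) (hj : j + 1 < t) : Ω t n ≃ Ω t n :=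
  Function.Involutive.toPerm _ (swapFun_involutive n j hj)

/-- `swapEquiv` acts as `swapFun`. [folklore] -/
@[simp] theorem swapEquiv_apply (j : ℕ) (hj : j + 1 < t) (ω : Ω t n) : swapEquiv n j hj ω = swapFun n j hj ω := rfl

/-- **The pool with a `G`-sample in slot `j + 1` is the pool with a uniform sample in slot `j`,
read through the coordinate permutation.** [Goldreich 2001, §3.2.3] [folklore] -/
theorem poolG_succ_eq_poolU_swap (j : ℕ) (hj : j + 1 < t) (ω : Ω t n) (m : ℕ) :
    poolG G n hG t (j + 1) ω m = poolU G n hG t j (swapFun n j hj ω) m := by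
  unfold poolG poolU
  by_cases hm : m < t
  · rw [ext_of_lt _ hm, ext_of_lt _ hm, swapFun_fst_mk, swapFun_snd_snd]
    rcases Nat.lt_trichotomy m j with h | h | h
    · have h1 : m < j + 1 := Nat.lt_succ_of_lt h
      have h2 : m ≠ j := h.ne
      have h3 : m ≠ j + 1 := by omega
      simp [h, h1, h2, h3]
    · subst h
      simp
    · have h1 : ¬ m < j + 1 := by omega
      have h2 : ¬ m < j := by omega
      have h3 : m ≠ j := by omega
      by_cases h' : m = j + 1
      · subst h'
        simp
      · simp [h1, h2, h3, h']
  · have hjm : j + 1 < m := lt_of_lt_of_le hj (not_lt.1 hm)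
    rw [if_neg (by omega), if_neg (by omega), if_neg (by omega), if_neg (by omega)]
    unfold ext
    rw [dif_neg hm, dif_neg hm]

/-- The seeds read by the pool with a `G`-sample in slot `0`: `σ` at round `0`, the first halves of
the blocks at later rounds. [Goldreich 2001, p. 192] [folklore] -/
def seedVec (ht : 0 < t) (ω : Ω t n) : Fin t → List.Vector Bool n :=
  fun m => if m = ⟨0, ht⟩ then ω.2.1 else fstHalf (ω.1 m)

/-- The pool with a `G`-sample in slot `0` is `G` of the seeds, below the round budget. [folklore] -/
theorem poolG_zero_eq (ht : 0 < t) (ω : Ω t n) {m : ℕ} (hm : m < t) :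
    poolG G n hG t 0 ω m = Gvec G n hG (ext t (seedVec n ht ω) m) := by
  unfold poolG seedVec
  rw [if_neg (Nat.not_lt_zero m), ext_of_lt _ hm, ext_of_lt _ hm]
  by_cases h : m = 0
  · subst h; simp
  · rw [if_neg h, if_neg (fun h' => h (congrArg Fin.val h'))]

/-- The seeds are a uniform coordinate: `ω ↦ (seedVec ω, rest)` is a bijection.
[Goldreich 2001, p. 192] [folklore] -/
def seedEquiv (ht : 0 < t) :
    Ω t n ≃ (Fin t → List.Vector Bool n) × ((Fin t → List.Vector Bool n) × List.Vector Bool n × List.Vector Bool (2 * n)) where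
  toFun ω := (seedVec n ht ω, (fun m => sndHalf (ω.1 m), fstHalf (ω.1 ⟨0, ht⟩), ω.2.2))
  invFun p := (fun m => vappend (if m = ⟨0, ht⟩ then p.2.2.1 else p.1 m) (p.2.1 m), p.1 ⟨0, ht⟩, p.2.2.2)
  left_inv ω := by
    obtain ⟨blk, σ, u⟩ := ω
    refine Prod.ext ?_ (Prod.ext ?_ rfl)
    · funext m
      by_cases h : m = ⟨0, ht⟩
      · subst h; simp
      · simp [seedVec, h]
    · simp [seedVec]
  right_inv p := by
    obtain ⟨f, g, a, u⟩ := p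
    refine Prod.ext ?_ (Prod.ext ?_ (Prod.ext ?_ rfl))
    · funext m
      by_cases h : m = ⟨0, ht⟩
      · subst h; simp [seedVec]
      · simp [seedVec, h]
    · funext m; simp
    · simp

/-- The pool read by the pool with a uniform sample in the last slot `t - 1`: the blocks, with the
sample in place of the last block. [Goldreich 2001, p. 192] [folklore] -/
def lastVec (ht : 0 < t) (ω : Ω t n) : Fin t → List.Vector Bool (2 * n) :=
  fun m => if m = ⟨t - 1, Nat.sub_lt ht Nat.one_pos⟩ then ω.2.2 else ω.1 m

/-- The pool with a uniform sample in slot `t - 1`, below the round budget. [folklore] -/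
theorem poolU_last_eq (ht : 0 < t) (ω : Ω t n) {m : ℕ} (hm : m < t) :
    poolU G n hG t (t - 1) ω m = ext t (lastVec n ht ω) m := by
  unfold poolU lastVec
  rw [ext_of_lt _ hm, ext_of_lt _ hm]
  by_cases h : m < t - 1
  · rw [if_pos h, if_neg (fun h' => by cases h'; omega)]
  · have hm' : m = t - 1 := by omega
    subst hm'
    rw [if_neg h, if_pos rfl, if_pos rfl]

/-- The last-slot pool is a uniform coordinate. [folklore] -/
def lastEquiv (ht : 0 < t) :
    Ω t n ≃ (Fin t → List.Vector Bool (2 * n)) × (List.Vector Bool (2 * n) × List.Vector Bool n) where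
  toFun ω := (lastVec n ht ω, (ω.1 ⟨t - 1, Nat.sub_lt ht Nat.one_pos⟩, ω.2.1))
  invFun p := (fun m => if m = ⟨t - 1, Nat.sub_lt ht Nat.one_pos⟩ then p.2.1 else p.1 m, p.2.2,
    p.1 ⟨t - 1, Nat.sub_lt ht Nat.one_pos⟩)
  left_inv ω := by
    obtain ⟨blk, σ, u⟩ := ω
    refine Prod.ext ?_ (Prod.ext rfl ?_)
    · funext m
      by_cases h : m = ⟨t - 1, Nat.sub_lt ht Nat.one_pos⟩
      · subst h; simp
      · simp [lastVec, h]
    · simp [lastVec]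
  right_inv p := by
    obtain ⟨f, b, σ⟩ := p
    refine Prod.ext ?_ (Prod.ext ?_ rfl)
    · funext m
      by_cases h : m = ⟨t - 1, Nat.sub_lt ht Nat.one_pos⟩
      · subst h; simp [lastVec]
      · simp [lastVec, h]
    · simp

/-- **From pair tables at level `i` to label tables at level `i + 1`**: the labels of the two
children are the halves of the pair (`({0,1}ⁱ → {0,1}²ⁿ) ≃ ({0,1}ⁱ⁺¹ → {0,1}ⁿ)`).
[Goldreich 2001, p. 189 ("placing truly random `n`-bit strings at level `k+1`")] [folklore] -/
def pairTableEquiv (i : ℕ) :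
    (List.Vector Bool i → List.Vector Bool (2 * n)) ≃ (List.Vector Bool (i + 1) → List.Vector Bool n) where
  toFun T₂ κ' := half (lastBit κ') (T₂ (vinit κ'))
  invFun T₁ κ := vappend (T₁ (vsnoc κ false)) (T₁ (vsnoc κ true))
  left_inv T₂ := by
    funext κ
    simp [half]
  right_inv T₁ := by
    funext κ'
    show half (lastBit κ') (vappend (T₁ (vsnoc (vinit κ') false)) (T₁ (vsnoc (vinit κ') true))) = T₁ κ'
    cases hb : lastBit κ' with
    | false =>
      have hκ : vsnoc (vinit κ') false = κ' := by rw [← hb, vsnoc_vinit_lastBit]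
      simp [half, hκ]
    | true =>
      have hκ : vsnoc (vinit κ') true = κ' := by rw [← hb, vsnoc_vinit_lastBit]
      simp [half, hκ]

/-- `pairTableEquiv` evaluated. [folklore] -/
theorem pairTableEquiv_apply (i : ℕ) (T₂ : List.Vector Bool i → List.Vector Bool (2 * n))
    (κ' : List.Vector Bool (i + 1)) : pairTableEquiv n i T₂ κ' = half (lastBit κ') (T₂ (vinit κ')) := rfl

/-- **The eager oracle with pair values at level `i` is the level-`(i+1)` hybrid** of the
corresponding label table. [Goldreich 2001, p. 189] [folklore] -/
theorem eagerOracle_postPair (i : ℕ) (hi : i < n) (T₂ : List.Vector Bool i → List.Vector Bool (2 * n)) :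
    eagerOracle (keyAt n i) (postPair G n i) T₂ = hybOracle G n (i + 1) (pairTableEquiv n i T₂) := by
  funext u
  by_cases hu : u.length = n
  · rw [hybOracle_of_length_eq G n (show i + 1 ≤ n from hi) _ hu, pairTableEquiv_apply, eagerOracle_apply,
      keyAt_of_length_eq n hi.le hu]
    simp only [postPair]
    have hlt : i < u.length := by rw [hu]; exact hi
    have hlast : lastBit (⟨u.take (i + 1), by rw [List.length_take, hu, min_eq_left (show i + 1 ≤ n from hi)]⟩ :
        List.Vector Bool (i + 1)) = u.getD i false := by
      simp only [lastBit, List.Vector.toList_mk, List.getD_eq_getElem?_getD]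
      rw [List.getElem?_take, if_pos (Nat.lt_succ_self i)]
    have hinit : vinit (⟨u.take (i + 1), by rw [List.length_take, hu, min_eq_left (show i + 1 ≤ n from hi)]⟩ :
        List.Vector Bool (i + 1)) = ⟨u.take i, by rw [List.length_take, hu, min_eq_left hi.le]⟩ :=
      List.Vector.eq _ _ (by simp [vinit, List.take_take])
    rw [hlast, hinit]
  · rw [hybOracle_of_length_ne G n _ hu, eagerOracle_apply]
    unfold keyAt
    rw [dif_neg (fun h' => hu h'.1)]

end Pools

/-! ### Transport of counting probabilities along a coordinate projection -/

section Transport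

variable {Ω₀ Ω₁ Ω₂ : Type*} [Fintype Ω₀] [Fintype Ω₁] [Fintype Ω₂] [Nonempty Ω₂]

/-- An event read through the first coordinate of a product decomposition of the sample space has
the probability of the event (uniform fibres). [folklore] -/
theorem uProb_equiv_fst (e : Ω₀ ≃ Ω₁ × Ω₂) (F : Ω₁ → Bool) :
    uProb (fun ω => F (e ω).1) = uProb F := by
  calc uProb (fun ω => F (e ω).1) = uProb (fun p : Ω₁ × Ω₂ => F (e (e.symm p)).1) :=
        (uProb_comp_equiv e.symm (fun ω => F (e ω).1)).symm
    _ = uProb (fun p : Ω₁ × Ω₂ => F p.1) := uProb_congr fun p => by rw [Equiv.apply_symm_apply]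
    _ = uProb F := uProb_fst F

end Transport

/-! ### The four identities of the hybrid argument -/

section Identities

variable (M : OracleAlg β) (x : List Bool) (G : List Bool → List Bool) (n : ℕ)
  (hG : ∀ s, (G s).length = 2 * s.length) (t : ℕ) [DecidableEq β] (b : β)

/-- The lazy run of the simulator at level `i` with a pool of pair values. [Goldreich 2001, p. 188
(algorithm `D`)] [folklore] -/
def lazyRunPair (i : ℕ) (pool : ℕ → List.Vector Bool (2 * n)) : Option β :=
  runRule M x (lazyRule M x (keyAt n i) (postPair G n i) pool) t []

/-- The run against the level-`i` hybrid with label table `T`. [Goldreich 2001, p. 187] [folklore] -/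
def hybRun (i : ℕ) (T : List.Vector Bool i → List.Vector Bool n) : Option β :=
  M.runAux (hybOracle G n i T) x t []

/-- **(I1) Neighbouring slots**: a `G`-sample in slot `j + 1` is distributed as a uniform sample in
slot `j` (both runs coincide pointwise after the coordinate permutation `swapEquiv`).
[Goldreich 2001, §3.2.3 (hybrid technique); GGM 1986, p. 801] [folklore] -/
theorem uProb_poolG_succ (i j : ℕ) (hj : j + 1 < t) :
    uProb (fun ω : Ω t n => decide (lazyRunPair M x G n t i (poolG G n hG t (j + 1) ω) = some b)) =
      uProb (fun ω : Ω t n => decide (lazyRunPair M x G n t i (poolU G n hG t j ω) = some b)) := by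
  have h : ∀ ω : Ω t n, poolG G n hG t (j + 1) ω = poolU G n hG t j (swapEquiv n j hj ω) :=
    fun ω => funext (poolG_succ_eq_poolU_swap G n hG j hj ω)
  calc uProb (fun ω : Ω t n => decide (lazyRunPair M x G n t i (poolG G n hG t (j + 1) ω) = some b))
      = uProb (fun ω : Ω t n => decide (lazyRunPair M x G n t i (poolU G n hG t j (swapEquiv n j hj ω)) = some b)) :=
        uProb_congr fun ω => by rw [h ω]
    _ = _ := uProb_comp_equiv (swapEquiv n j hj) (fun ω : Ω t n => decide (lazyRunPair M x G n t i (poolU G n hG t j ω) = some b))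

/-- **(I2) The first slot**: with a `G`-sample in slot `0` the simulator runs the level-`i` hybrid
(pool congruence, transport along `seedEquiv`, the lazy/eager principle with seed values).
[Goldreich 2001, Claim 3.6.6.1 (second case: "`M` is invoked with access to the `k`th hybrid");
GGM 1986, p. 801 ("`A_T` simulates a computation of `T` with oracle `A_i`")] [folklore] -/
theorem uProb_poolG_zero (i : ℕ) (hi : i < n) (ht : 0 < t) :
    uProb (fun ω : Ω t n => decide (lazyRunPair M x G n t i (poolG G n hG t 0 ω) = some b)) =
      uProb (fun T : List.Vector Bool i → List.Vector Bool n => decide (hybRun M x G n t i T = some b)) := by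
  have h1 : ∀ ω : Ω t n, lazyRunPair M x G n t i (poolG G n hG t 0 ω) =
      runRule M x (lazyRule M x (keyAt n i) (postSeed G n i) (ext t (seedVec n ht ω))) t [] := by
    intro ω
    unfold lazyRunPair
    rw [runRule_lazyRule_congr M x (keyAt n i) (postPair G n i) t
      (pool₂ := fun m => Gvec G n hG (ext t (seedVec n ht ω) m)) (fun m hm => poolG_zero_eq G n hG ht ω hm),
      lazyRule_postPair_Gvec G n hG hi]
  have h2 := uProb_equiv_fst (seedEquiv n (t := t) ht)
    (fun pool : Fin t → List.Vector Bool n =>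
      decide (runRule M x (lazyRule M x (keyAt n i) (postSeed G n i) (ext t pool)) t [] = some b))
  have h3 := uProb_lazy_eq_eager M x (keyAt n i) (postSeed G n i) t b
  calc uProb (fun ω : Ω t n => decide (lazyRunPair M x G n t i (poolG G n hG t 0 ω) = some b))
      = uProb (fun ω : Ω t n =>
          decide (runRule M x (lazyRule M x (keyAt n i) (postSeed G n i) (ext t ((seedEquiv n ht ω).1))) t [] = some b)) :=
        uProb_congr fun ω => by rw [h1 ω]; rfl
    _ = _ := h2
    _ = _ := h3

/-- **(I3) The last slot**: with a uniform sample in slot `t - 1` the simulator runs the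
level-`(i+1)` hybrid (pool congruence, transport along `lastEquiv`, the lazy/eager principle with
pair values, the table bijection `pairTableEquiv`). [Goldreich 2001, Claim 3.6.6.1 (first case:
"`M` is invoked with access to the `k+1` hybrid"); GGM 1986, p. 801 ("… with oracle `A_{i+1}`")] [folklore] -/
theorem uProb_poolU_last (i : ℕ) (hi : i < n) (ht : 0 < t) :
    uProb (fun ω : Ω t n => decide (lazyRunPair M x G n t i (poolU G n hG t (t - 1) ω) = some b)) =
      uProb (fun T : List.Vector Bool (i + 1) → List.Vector Bool n => decide (hybRun M x G n t (i + 1) T = some b)) := by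
  have h1 : ∀ ω : Ω t n, lazyRunPair M x G n t i (poolU G n hG t (t - 1) ω) =
      runRule M x (lazyRule M x (keyAt n i) (postPair G n i) (ext t (lastVec n ht ω))) t [] := fun ω =>
    runRule_lazyRule_congr M x (keyAt n i) (postPair G n i) t (fun m hm => poolU_last_eq G n hG ht ω hm)
  have h2 := uProb_equiv_fst (lastEquiv n (t := t) ht)
    (fun pool : Fin t → List.Vector Bool (2 * n) =>
      decide (runRule M x (lazyRule M x (keyAt n i) (postPair G n i) (ext t pool)) t [] = some b))
  have h3 := uProb_lazy_eq_eager M x (keyAt n i) (postPair G n i) t b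
  have h4 : uProb (fun T₂ : List.Vector Bool i → List.Vector Bool (2 * n) =>
        decide (M.runAux (eagerOracle (keyAt n i) (postPair G n i) T₂) x t [] = some b)) =
      uProb (fun T : List.Vector Bool (i + 1) → List.Vector Bool n => decide (hybRun M x G n t (i + 1) T = some b)) := by
    have := uProb_comp_equiv (pairTableEquiv n i)
      (fun T : List.Vector Bool (i + 1) → List.Vector Bool n => decide (hybRun M x G n t (i + 1) T = some b))
    rw [← this]
    exact uProb_congr fun T₂ => by rw [eagerOracle_postPair G n i hi]; rfl
  calc uProb (fun ω : Ω t n => decide (lazyRunPair M x G n t i (poolU G n hG t (t - 1) ω) = some b))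
      = uProb (fun ω : Ω t n =>
          decide (runRule M x (lazyRule M x (keyAt n i) (postPair G n i) (ext t ((lastEquiv n ht ω).1))) t [] = some b)) :=
        uProb_congr fun ω => by rw [h1 ω]; rfl
    _ = _ := h2
    _ = _ := h3
    _ = _ := h4

/-- Telescoping of a sum whose terms pair off with a shift. [folklore] -/
theorem sum_range_sub_telescope {f g : ℕ → ℝ} :
    ∀ {t : ℕ}, 0 < t → (∀ j, j + 1 < t → f (j + 1) = g j) → ∑ j ∈ range t, (f j - g j) = f 0 - g (t - 1)
  | 0, ht, _ => absurd ht (lt_irrefl 0)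
  | 1, _, _ => by simp
  | t + 2, _, h => by
    rw [Finset.sum_range_succ, sum_range_sub_telescope (t := t + 1) (Nat.succ_pos t)
      (fun j hj => h j (Nat.lt_succ_of_lt hj)), h t (Nat.lt_succ_self _)]
    simp

/-- **(I4) One level**: summed over the slots, the gaps between a `G`-sample and a uniform sample
telescope to the gap between the level-`i` and level-`(i+1)` hybrids.
[GGM 1986, p. 801–802; Goldreich 2001, p. 192] [folklore] -/
theorem sum_uProb_poolG_sub_poolU (i : ℕ) (hi : i < n) (ht : 0 < t) :
    ∑ j ∈ range t, (uProb (fun ω : Ω t n => decide (lazyRunPair M x G n t i (poolG G n hG t j ω) = some b)) -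
        uProb (fun ω : Ω t n => decide (lazyRunPair M x G n t i (poolU G n hG t j ω) = some b))) =
      uProb (fun T : List.Vector Bool i → List.Vector Bool n => decide (hybRun M x G n t i T = some b)) -
        uProb (fun T : List.Vector Bool (i + 1) → List.Vector Bool n => decide (hybRun M x G n t (i + 1) T = some b)) := by
  rw [sum_range_sub_telescope ht (fun j hj => uProb_poolG_succ M x G n hG t b i j hj),
    uProb_poolG_zero M x G n hG t b i hi ht, uProb_poolU_last M x G n hG t b i hi ht]

/-- **The telescoping identity of the GGM hybrid argument**: summed over levels `i < n` and slots
`j < t`, the gaps are the gap between the extreme hybrids `H_n^0` and `H_n^n`.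
[GGM 1986, p. 802 ("these probabilities differ by at least `(1/k)·|p_k^0 − p_k^k|`");
Goldreich 2001, p. 192 (the display before §3.6.3)] [folklore] -/
theorem sum_sum_uProb_poolG_sub_poolU (ht : 0 < t) :
    ∑ i ∈ range n, ∑ j ∈ range t,
        (uProb (fun ω : Ω t n => decide (lazyRunPair M x G n t i (poolG G n hG t j ω) = some b)) -
          uProb (fun ω : Ω t n => decide (lazyRunPair M x G n t i (poolU G n hG t j ω) = some b))) =
      uProb (fun T : List.Vector Bool 0 → List.Vector Bool n => decide (hybRun M x G n t 0 T = some b)) -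
        uProb (fun T : List.Vector Bool n → List.Vector Bool n => decide (hybRun M x G n t n T = some b)) := by
  rw [← Finset.sum_range_sub' (fun i => uProb (fun T : List.Vector Bool i → List.Vector Bool n => decide (hybRun M x G n t i T = some b))) n]
  exact Finset.sum_congr rfl fun i hi => sum_uProb_poolG_sub_poolU M x G n hG t b i (mem_range.1 hi) ht

/-- The constant table is the only way to read a key-less table: `{0,1}ⁿ ≃ ({0,1}⁰ → {0,1}ⁿ)`. [folklore] -/
def rootEquiv : List.Vector Bool n ≃ (List.Vector Bool 0 → List.Vector Bool n) where
  toFun k := fun _ => k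
  invFun T := T ⟨[], rfl⟩
  left_inv _ := rfl
  right_inv T := by
    funext v
    have hv : v = ⟨[], rfl⟩ := List.Vector.eq _ _ (List.eq_nil_of_length_eq_zero v.toList_length)
    rw [hv]

/-- **The extreme hybrid `H_n^0` is the real game** with a uniform key at the root.
[Goldreich 2001, p. 187; GGM 1986, p. 801 (`p_k^0 = p_k^F`)] [folklore] -/
theorem uProb_hybRun_zero :
    uProb (fun T : List.Vector Bool 0 → List.Vector Bool n => decide (hybRun M x G n t 0 T = some b)) =
      uProb (fun k : List.Vector Bool n => decide (M.runAux (oracleOfFnAt n (ggmEnsemble G n k.toList)) x t [] = some b)) := by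
  rw [← uProb_comp_equiv (rootEquiv n) (fun T : List.Vector Bool 0 → List.Vector Bool n => decide (hybRun M x G n t 0 T = some b))]
  refine uProb_congr fun k => ?_
  simp only [hybRun, hybOracle_zero]
  rfl

/-- **The extreme hybrid `H_n^n` is the ideal game** with a uniformly random function table.
[Goldreich 2001, p. 187; GGM 1986, p. 801 (`p_k^k = p_k^H`)] [folklore] -/
theorem uProb_hybRun_self :
    uProb (fun T : List.Vector Bool n → List.Vector Bool n => decide (hybRun M x G n t n T = some b)) =
      uProb (fun T : List.Vector Bool n → List.Vector Bool n => decide (M.runAux (oracleOfTable T) x t [] = some b)) :=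
  uProb_congr fun T => by simp only [hybRun, hybOracle_self]

end Identities

end GGMHyb

end Literature.Computability.Cryptography
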